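import Mathlib
import Summits.Ventures.FusionMHD.Models.RwmFRS1
import HarnessLib

/-!
# F3.r4 instance «RwmFRS1», companion mode `(4,1)`: Newcomb's `f`, `g` in closed form, the marginal equation in certificate
# form and the boundary form of `δW` for the external `(m,n) = (4,1)` mode of the FRS1 screw pinch

The `m = 4` copy of `RwmFRS1.lean` (model-6 g6): same MODEL M_RWM (`P = TearingFRS1.Sigma.dyn`, `kk = −1/5`, vacuum + thin
wall), CLASS C = the external helical mode `(4,1)` (`q_a = 14/5 < 4`; `F = (13 − 7r²)/(35(1+r²)) ≠ 0` in the plasma, the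
`q = 4` surface `r² = 13/7` lies outside). Closed forms (`kDotB_eq` … `newcombG_eq`; `g = r(13−7r²)G₄(r²)/(1225(1+r²)²(r²+400)²)`,
`G₄(s) = (13−7s)(s+375)(s+400) − 50s(27+7s) = 1950000 − 1041275s − 5762s² − 7s³ > 0` on `[0,1]`), the marginal equation
`P₂ξ″ + P₁ξ′ + P₀ξ = 0` with integer polynomials (`rwmEq4`), the bridge `newcomb_of_isSolOn`, the edge values `F_a = 3/35`,
`F†_a = −17/35`, `k₀²(a) = 401/25`, and the boundary form **`δŴ₄(L, Λ) = (9L − 51)/19649 + 9Λ/4900`**,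
`Λ_crit,4(L) = (51 − 9L)·4900/176841` [cite: Freidberg2014, §11.5.6 eq. (11.148)–(11.149)]. Float preview (VALIDATED):
`L₄ = 5.618`, `Λ_crit,4 = 0.012 < 20/21 ≤ Λ_∞` — the `(4,1)` mode is on the no-wall-STABLE side of M_RWM (kernel statement in
`RwmFRS1M4Energy.lean`). Nothing about a device. [instance data]
-/

noncomputable section

open Set Polynomial Literature.MathematicalPhysics.MHD Literature.Computation.Certificates
  Literature.Computation.Certificates.LinearODE

namespace Summit.Ventures.FusionMHD.Models

namespace RwmFRS1

namespace M4

/-! ### Closed forms of `F`, `F†`, `k₀²`, `f`, `g` for `(m, k) = (4, −1/5)` -/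

/-- `F = kB_z + 4B_θ/r = (13 − 7r²)/(35(1+r²))` (`r ≠ 0`). [cite: Freidberg2014, §11.5.1 eq. (11.90)] -/
theorem kDotB_eq {r : ℝ} (hr : r ≠ 0) : P.kDotB 4 kk r = (13 - 7 * r ^ 2) / (35 * (1 + r ^ 2)) := by
  have h1 : (0 : ℝ) < 1 + r ^ 2 := by positivity
  rw [ScrewPinch.Profile.kDotB, P_Bθ, P_Bz, kk]
  field_simp
  ring

/-- `F† = kB_z − 4B_θ/r = −(27 + 7r²)/(35(1+r²))` (`r ≠ 0`). [cite: Freidberg2014, §11.5.1 eq. (11.89)] -/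
theorem kDotBDagger_eq {r : ℝ} (hr : r ≠ 0) : P.kDotBDagger 4 kk r = -(27 + 7 * r ^ 2) / (35 * (1 + r ^ 2)) := by
  have h1 : (0 : ℝ) < 1 + r ^ 2 := by positivity
  rw [ScrewPinch.Profile.kDotBDagger, P_Bθ, P_Bz, kk]
  field_simp
  ring

/-- `k₀² = k² + 16/r² = (r² + 400)/(25r²)` (`r ≠ 0`). [cite: Freidberg2014, §11.5.1 eq. (11.85)] -/
theorem k0Sq_eq {r : ℝ} (hr : r ≠ 0) : ScrewPinch.Profile.k0Sq 4 kk r = (r ^ 2 + 400) / (25 * r ^ 2) := by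
  rw [ScrewPinch.Profile.k0Sq, kk]
  field_simp
  ring

/-- `f = rF²/k₀² = r³(13−7r²)²/(49(1+r²)²(r²+400))` (`r ≠ 0`). [cite: Freidberg2014, §11.5.1 eq. (11.90)] -/
theorem newcombF_eq {r : ℝ} (hr : r ≠ 0) :
    P.newcombF 4 kk r = r ^ 3 * (13 - 7 * r ^ 2) ^ 2 / (49 * (1 + r ^ 2) ^ 2 * (r ^ 2 + 400)) := by
  have h1 : (0 : ℝ) < 1 + r ^ 2 := by positivity
  have h2 : (0 : ℝ) < r ^ 2 + 400 := by positivity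
  rw [ScrewPinch.Profile.newcombF, kDotB_eq hr, k0Sq_eq hr]
  field_simp
  ring

/-- The cubic `G₄(s) = (13−7s)(s+375)(s+400) − 50s(27+7s) = 1950000 − 1041275s − 5762s² − 7s³`. [instance data] -/
def Gpoly (s : ℝ) : ℝ := 1950000 - 1041275 * s - 5762 * s ^ 2 - 7 * s ^ 3

/-- `G₄(s) = (13−7s)(s+375)(s+400) − 50s(27+7s)`. [instance data] -/
theorem Gpoly_eq (s : ℝ) : M4.Gpoly s = (13 - 7 * s) * (s + 375) * (s + 400) - 50 * s * (27 + 7 * s) := by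
  unfold M4.Gpoly; ring

/-- `G₄ > 0` on `[0, 1]` (`≥ 1950000 − 1041275 − 5762 − 7 = 902956` there). [instance data] -/
theorem Gpoly_pos {s : ℝ} (h0 : 0 ≤ s) (h1 : s ≤ 1) : 0 < M4.Gpoly s := by
  unfold M4.Gpoly
  have h2 : s ^ 2 ≤ 1 := by nlinarith
  have h3 : s ^ 3 ≤ 1 := by nlinarith
  nlinarith

/-- `g = r(13−7r²)G₄(r²)/(1225(1+r²)²(r²+400)²)` (`r ≠ 0`; `p′ = 0`). [cite: Freidberg2014, §11.5.1 eq. (11.90)] -/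
theorem newcombG_eq {r : ℝ} (hr : r ≠ 0) :
    P.newcombG 4 kk r = r * (13 - 7 * r ^ 2) * M4.Gpoly (r ^ 2) / (1225 * (1 + r ^ 2) ^ 2 * (r ^ 2 + 400) ^ 2) := by
  have h1 : (0 : ℝ) < 1 + r ^ 2 := by positivity
  have h2 : (0 : ℝ) < r ^ 2 + 400 := by positivity
  have hp : deriv P.p r = 0 := by
    rw [show P.p = fun _ => (0 : ℝ) from funext P_p, deriv_const]
  rw [ScrewPinch.Profile.newcombG, hp, kDotB_eq hr, kDotBDagger_eq hr, k0Sq_eq hr, M4.Gpoly, kk, P_μ₀]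
  field_simp
  ring

/-- `F ≠ 0` on `0 < r`, `r² < 13/7`. [instance data] -/
theorem kDotB_ne_zero {r : ℝ} (hr : 0 < r) (h : r ^ 2 < 13 / 7) : P.kDotB 4 kk r ≠ 0 := by
  rw [kDotB_eq hr.ne']
  have h1 : (0 : ℝ) < 1 + r ^ 2 := by positivity
  exact div_ne_zero (by nlinarith) (by positivity)

/-- `f > 0` on `0 < r`, `r² < 13/7`. [instance data] -/
theorem newcombF_pos {r : ℝ} (hr : 0 < r) (h : r ^ 2 < 13 / 7) : 0 < P.newcombF 4 kk r := by
  rw [newcombF_eq hr.ne']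
  have h3 : (0 : ℝ) < (13 - 7 * r ^ 2) ^ 2 := by nlinarith
  positivity

/-- `g > 0` on the plasma `0 < r ≤ 1`. [instance data] -/
theorem newcombG_pos {r : ℝ} (hr : 0 < r) (h : r ≤ 1) : 0 < P.newcombG 4 kk r := by
  rw [newcombG_eq hr.ne']
  have hr2 : r ^ 2 ≤ 1 := by nlinarith
  have hG := Gpoly_pos (sq_nonneg r) hr2
  have h8 : (0 : ℝ) < 13 - 7 * r ^ 2 := by nlinarith
  positivity

/-! ### The marginal equation in certificate form and the bridge -/

/-- The marginal equation of the `(4,1)` mode cleared of denominators: `P₂ = 25r²(13−7r²)(1+r²)(r²+400)`,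
`P₁ = 25r(15600 − 24787r² − 8474r⁴ − 7r⁶)`, `P₀ = −(1+r²)G₄(r²)`. [instance data] -/
def rwmEq4 : Equation :=
  ⟨[0, 0, 130000, 0, 60325, 0, -69850, 0, -175], [0, 390000, 0, -619675, 0, -211850, 0, -175],
    [-1950000, 0, -908725, 0, 1047037, 0, 5769, 0, 7]⟩

/-- `P₂(r) = 25r²(13−7r²)(1+r²)(r²+400)`. [instance data] -/
theorem eval_P2 (r : ℝ) :
    (toPolyR M4.rwmEq4.P2).eval r = 25 * r ^ 2 * (13 - 7 * r ^ 2) * (1 + r ^ 2) * (r ^ 2 + 400) := by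
  simp [M4.rwmEq4, toPolyR, Finset.sum_range_succ]
  ring

/-- `P₁(r) = 25r(15600 − 24787r² − 8474r⁴ − 7r⁶)`. [instance data] -/
theorem eval_P1 (r : ℝ) :
    (toPolyR M4.rwmEq4.P1).eval r = 25 * r * (15600 - 24787 * r ^ 2 - 8474 * r ^ 4 - 7 * r ^ 6) := by
  simp [M4.rwmEq4, toPolyR, Finset.sum_range_succ]
  ring

/-- `P₀(r) = −(1+r²)G₄(r²)`. [instance data] -/
theorem eval_P0 (r : ℝ) : (toPolyR M4.rwmEq4.P0).eval r = -(1 + r ^ 2) * M4.Gpoly (r ^ 2) := by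
  rw [M4.Gpoly]
  simp [M4.rwmEq4, toPolyR, Finset.sum_range_succ]
  try ring

/-- `P₂ ≠ 0` on `0 < r`, `r² < 13/7`. [instance data] -/
theorem eval_P2_ne_zero {r : ℝ} (hr : 0 < r) (h : r ^ 2 < 13 / 7) : (toPolyR M4.rwmEq4.P2).eval r ≠ 0 := by
  rw [eval_P2]
  have h8 : (0 : ℝ) < 13 - 7 * r ^ 2 := by linarith
  positivity

/-- `𝔭 = −P₁/P₂`. [instance data] -/
theorem pH_eq {r : ℝ} (hr : 0 < r) (h : r ^ 2 < 13 / 7) :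
    M4.rwmEq4.pH r = -(15600 - 24787 * r ^ 2 - 8474 * r ^ 4 - 7 * r ^ 6) /
      (r * (13 - 7 * r ^ 2) * (1 + r ^ 2) * (r ^ 2 + 400)) := by
  have h8 : (13 - 7 * r ^ 2 : ℝ) ≠ 0 := by nlinarith
  have h1 : (0 : ℝ) < 1 + r ^ 2 := by positivity
  have h2 : (0 : ℝ) < r ^ 2 + 400 := by positivity
  have hr0 := hr.ne'
  rw [Equation.pH, eval_P1, eval_P2]
  field_simp

/-- `𝔮 = −P₀/P₂ = g/f`. [instance data] -/
theorem qH_eq (r : ℝ) :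
    M4.rwmEq4.qH r = (1 + r ^ 2) * M4.Gpoly (r ^ 2) / (25 * r ^ 2 * (13 - 7 * r ^ 2) * (1 + r ^ 2) * (r ^ 2 + 400)) := by
  rw [Equation.qH, eval_P0, eval_P2]
  ring

/-- `f′ = r²(13−7r²)(15600 − 24787r² − 8474r⁴ − 7r⁶)/(49(1+r²)³(r²+400)²)` on `0 < r`. [instance data] -/
theorem hasDerivAt_newcombF {r : ℝ} (hr : 0 < r) :
    HasDerivAt (P.newcombF 4 kk)
      (r ^ 2 * (13 - 7 * r ^ 2) * (15600 - 24787 * r ^ 2 - 8474 * r ^ 4 - 7 * r ^ 6) /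
        (49 * (1 + r ^ 2) ^ 3 * (r ^ 2 + 400) ^ 2)) r := by
  have h1 : (0 : ℝ) < 1 + r ^ 2 := by positivity
  have h2 : (0 : ℝ) < r ^ 2 + 400 := by positivity
  have hev : (fun s => s ^ 3 * (13 - 7 * s ^ 2) ^ 2 / (49 * (1 + s ^ 2) ^ 2 * (s ^ 2 + 400))) =ᶠ[nhds r]
      P.newcombF 4 kk := by
    filter_upwards [isOpen_Ioi.mem_nhds hr] with s hs
    rw [newcombF_eq (ne_of_gt hs)]
  have hd : HasDerivAt (fun s : ℝ => s ^ 3 * (13 - 7 * s ^ 2) ^ 2 / (49 * (1 + s ^ 2) ^ 2 * (s ^ 2 + 400)))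
      (((3 * r ^ 2 * (13 - 7 * r ^ 2) ^ 2 + r ^ 3 * (2 * (13 - 7 * r ^ 2) * (-(7 * (2 * r))))) *
          (49 * (1 + r ^ 2) ^ 2 * (r ^ 2 + 400)) -
        r ^ 3 * (13 - 7 * r ^ 2) ^ 2 * (49 * (2 * (1 + r ^ 2) * (2 * r)) * (r ^ 2 + 400) + 49 * (1 + r ^ 2) ^ 2 * (2 * r))) /
        (49 * (1 + r ^ 2) ^ 2 * (r ^ 2 + 400)) ^ 2) r := by
    have hnum : HasDerivAt (fun s : ℝ => s ^ 3 * (13 - 7 * s ^ 2) ^ 2)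
        (3 * r ^ 2 * (13 - 7 * r ^ 2) ^ 2 + r ^ 3 * (2 * (13 - 7 * r ^ 2) * (-(7 * (2 * r))))) r := by
      have ha := hasDerivAt_pow 3 r
      have hb : HasDerivAt (fun s : ℝ => 13 - 7 * s ^ 2) (-(7 * (2 * r))) r := by
        simpa using ((hasDerivAt_pow 2 r).const_mul 7).const_sub 13
      have hb2 := hb.pow 2
      exact (ha.mul hb2).congr_deriv (by simp only [Pi.pow_apply]; push_cast; ring)
    have hden : HasDerivAt (fun s : ℝ => 49 * (1 + s ^ 2) ^ 2 * (s ^ 2 + 400))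
        (49 * (2 * (1 + r ^ 2) * (2 * r)) * (r ^ 2 + 400) + 49 * (1 + r ^ 2) ^ 2 * (2 * r)) r := by
      have hc : HasDerivAt (fun s : ℝ => 1 + s ^ 2) (2 * r) r := by
        simpa using (hasDerivAt_pow 2 r).const_add 1
      have hc2 := (hc.pow 2).const_mul 49
      have he : HasDerivAt (fun s : ℝ => s ^ 2 + 400) (2 * r) r := by
        simpa using (hasDerivAt_pow 2 r).add_const 400
      exact (hc2.mul he).congr_deriv (by simp only [Pi.pow_apply]; push_cast; ring)
    exact hnum.div hden (by positivity)
  refine (hd.congr_of_eventuallyEq hev.symm).congr_deriv ?_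
  field_simp
  ring

/-- **BRIDGE** (`m = 4`): a certificate solution of `rwmEq4` on an open `s ⊆ {0 < r, r² < 13/7}` satisfies
`d/dr (f · deriv ξ) = g ξ` there. [cite: Freidberg2014, §11.5.3 eq. (11.110)] -/
theorem newcomb_of_isSolOn {ξ ξ' : ℝ → ℝ} {s : Set ℝ} (hs : IsOpen s) (hsub : ∀ r ∈ s, 0 < r ∧ r ^ 2 < 13 / 7)
    (hsol : M4.rwmEq4.IsSolOn ξ ξ' s) {r : ℝ} (hr : r ∈ s) :
    HasDerivAt (fun x => P.newcombF 4 kk x * deriv ξ x) (P.newcombG 4 kk r * ξ r) r := by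
  obtain ⟨hr0, hr8⟩ := hsub r hr
  obtain ⟨h1, h2⟩ := hsol r hr
  have hev : ξ' =ᶠ[nhds r] deriv ξ := by
    filter_upwards [hs.mem_nhds hr] with x hx
    exact ((hsol x hx).1.deriv).symm
  have h2' : HasDerivAt (deriv ξ) (M4.rwmEq4.pH r * ξ' r + M4.rwmEq4.qH r * ξ r) r :=
    h2.congr_of_eventuallyEq hev.symm
  have hf := hasDerivAt_newcombF hr0
  have hprod := hf.mul h2'
  refine hprod.congr_deriv ?_
  rw [h1.deriv, newcombF_eq hr0.ne', newcombG_eq hr0.ne', pH_eq hr0 hr8, qH_eq]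
  have h8 : (13 - 7 * r ^ 2 : ℝ) ≠ 0 := by nlinarith
  have h1' : (0 : ℝ) < 1 + r ^ 2 := by positivity
  have h2'' : (0 : ℝ) < r ^ 2 + 400 := by positivity
  have hr0' := hr0.ne'
  field_simp
  ring

/-! ### The boundary form at `a = 1`, `m = 4` -/

/-- Edge values: `F_a = 3/35`, `F†_a = −17/35`, `k₀²(a) = 401/25`, `f(a) = 9/19649`. [instance data] -/
theorem edge_values : P.kDotB 4 kk 1 = 3 / 35 ∧ P.kDotBDagger 4 kk 1 = -17 / 35 ∧
    ScrewPinch.Profile.k0Sq 4 kk 1 = 401 / 25 ∧ P.newcombF 4 kk 1 = 9 / 19649 := by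
  refine ⟨?_, ?_, ?_, ?_⟩
  · rw [kDotB_eq one_ne_zero]; norm_num
  · rw [kDotBDagger_eq one_ne_zero]; norm_num
  · rw [k0Sq_eq one_ne_zero]; norm_num
  · rw [newcombF_eq one_ne_zero]; norm_num

/-- The boundary form of the `(4,1)` reference energies per `ξ(a)²`: `(F²/k₀²)L + FF†/k₀² + a²F²Λ/4` at `a = 1`.
[cite: Freidberg2014, §11.5.6 eq. (11.148)–(11.149)] -/
def boundaryForm (L Λ : ℝ) : ℝ :=
  P.kDotB 4 kk 1 ^ 2 / ScrewPinch.Profile.k0Sq 4 kk 1 * L +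
    P.kDotB 4 kk 1 * P.kDotBDagger 4 kk 1 / ScrewPinch.Profile.k0Sq 4 kk 1 +
    1 ^ 2 * P.kDotB 4 kk 1 ^ 2 * Λ / 4

/-- **`δŴ₄(L, Λ) = (9L − 51)/19649 + 9Λ/4900`** (exact). [instance data] -/
theorem boundaryForm_eq (L Λ : ℝ) : M4.boundaryForm L Λ = (9 * L - 51) / 19649 + 9 * Λ / 4900 := by
  obtain ⟨e1, e2, e3, -⟩ := edge_values
  rw [M4.boundaryForm, e1, e2, e3]
  ring

/-- `δŴ₄` is lit-4's right-hand side at `a = 1`, `m = 4`. [cite: Freidberg2014, §11.5.3 eq. (11.118)] -/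
theorem boundaryForm_mul (ξ₁ : ℝ → ℝ) (Λ : ℝ) :
    (P.kDotB 4 kk 1 ^ 2 / ScrewPinch.Profile.k0Sq 4 kk 1 * (1 * deriv ξ₁ 1 / ξ₁ 1) +
        P.kDotB 4 kk 1 * P.kDotBDagger 4 kk 1 / ScrewPinch.Profile.k0Sq 4 kk 1 +
        1 ^ 2 * P.kDotB 4 kk 1 ^ 2 * Λ / 4) * ξ₁ 1 ^ 2 =
      M4.boundaryForm (1 * deriv ξ₁ 1 / ξ₁ 1) Λ * ξ₁ 1 ^ 2 := by
  rw [M4.boundaryForm]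

/-- The critical wall factor of the `(4,1)` mode: `Λ_crit,4(L) = (51 − 9L)·4900/176841`, i.e.
`δŴ₄ = 9(Λ − Λ_crit,4)/4900`. [instance data] -/
def lambdaCrit (L : ℝ) : ℝ := (51 - 9 * L) * 4900 / 176841

/-- `δŴ₄(L, Λ) = 9(Λ − Λ_crit,4)/4900`. [instance data] -/
theorem boundaryForm_eq_sub (L Λ : ℝ) : M4.boundaryForm L Λ = 9 * (Λ - M4.lambdaCrit L) / 4900 := by
  rw [boundaryForm_eq, M4.lambdaCrit]
  ring

/-- `δŴ₄ > 0 ⟺ Λ > Λ_crit,4`. [instance data] -/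
theorem boundaryForm_pos_iff (L Λ : ℝ) : 0 < M4.boundaryForm L Λ ↔ M4.lambdaCrit L < Λ := by
  rw [boundaryForm_eq_sub]
  constructor
  · intro h; by_contra hle; rw [not_lt] at hle
    have : 9 * (Λ - M4.lambdaCrit L) / 4900 ≤ 0 := div_nonpos_of_nonpos_of_nonneg (by linarith) (by norm_num)
    linarith
  · intro h; exact div_pos (by linarith) (by norm_num)

end M4

end RwmFRS1

end Summit.Ventures.FusionMHD.Models

end
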